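import Summits.CriticalPhenomena.PercolationContinuityZ3.Theorems.Transplant.PlanarSkeletonFrmFromDefs
import Summits.CriticalPhenomena.PercolationContinuityZ3.Theorems.Transplant.SkelFrmFrom1ChoiceDefs
import Summits.CriticalPhenomena.PercolationContinuityZ3.Theorems.Transplant.SkelFrm1ChoiceDefs
import Summits.CriticalPhenomena.PercolationContinuityZ3.Theorems.Transplant.SkelPhiRootServe
import HarnessLib
import Summits.CriticalPhenomena.PercolationContinuityZ3.Theorems.Transplant.SkelFrm1Serve
/-!
# U-WAVE PORT (RULING D-U, lead g21 2026-08-26; WAVE-U-MANIFEST v3.0 row «SkelFrm1Serve» ↦ «SkelFrmFrom1Serve») of the tree module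
# `Transplant/SkelFrm1Serve` onto the carrier `PlanarSkeletonFrmFrom` (frames only, cylinders connected from width `ℓ₀` on)

ORIGINAL TITLE: N2 (the frames-only node `SamePDropOfSkeletonFrmFrom₁`, OPEN), (c2) junction for ALL columns: THE STEP-I‴ INPUTS AT EVERY CENTRE, SERVED FROM `AtQNQ` —

builds on p205010 (kernel theorem, internal audit signed; external expert review pending) — nothing in this file uses p205010; NOTHING is claimed about the
OPEN node U `SamePDropOfSkeletonFrmFrom₁` (nor U_s / the end state).  Lane `prim-bschramm`, seat `prim-bschramm-p3` gen 26; helper file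
(`--supports stmt-CriticalPhenomena-4575 --as helper`).  PORT RULES r1–r4 of RULING D-U: declaration order and proof texts are those of the original,
byte-identical except (i) the carrier token `PlanarSkeletonFrm ↦ PlanarSkeletonFrmFrom` (binders, `namespace`/`end` lines, qualified names of twinned
declarations), (ii) carrier-FREE declarations of the original (φ-level `Skelφ…` blocks and namespace-only arithmetic residents) are NOT re-declared —
this file imports the original and `export`s the twin-free residents (POLICY T / treatment (m1)); residents whose statement mentions a twinned
constant are copied, (iii) every carrier-binding declaration keeps its explicit binder `(Φ : PlanarSkeletonFrmFrom G)` in its own signature (r2).  Docstrings and citations are the original's.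
-/

noncomputable section

open scoped Classical

namespace Summit.CriticalPhenomena.PercolationContinuityZ3.Theorems.Transplant

open MeasureTheory Literature.Probability.Percolation Literature.Probability.LatticeModels SimpleGraph KNCells KNLevels

namespace Skelφ.StepI

variable {V : Type}

end Skelφ.StepI

namespace PlanarSkeletonFrmFrom

open SkelConc (Consts)
open Skelφ (oriφ trφ)
open Skelφ.StepI (DataN OutNS eventNAt)

variable {V : Type} [Countable V] {G : SimpleGraph V} [G.LocallyFinite]

omit [Countable V] in
/-- Under the one-type hypothesis every centre is a frame image of the base vertex (frames-only skeleton). [folklore] -/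
theorem exists_frame_of_types_eq' (Φ : PlanarSkeletonFrmFrom G) {t : V} (h1 : Φ.types = {t}) (c : V) :
    ∃ α : G ≃g G, α t = c ∧ ∀ w, PlanarSkeletonFrmFrom.φ Φ (α w) = PlanarSkeletonFrmFrom.φ Φ w + (PlanarSkeletonFrmFrom.φ Φ c - PlanarSkeletonFrmFrom.φ Φ t) := by
  obtain ⟨t', ht', α, hαt, hφ⟩ := Φ.frame c
  rw [h1, Finset.mem_singleton] at ht'
  subst ht'
  exact ⟨α, hαt, hφ⟩

namespace ChoiceNQ

variable {κ : Consts} {Φ : PlanarSkeletonFrmFrom G} {t : V} {p : unitInterval} {hC : Φ.CylSubcritical p} {O : OutNS V} {q : unitInterval}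

/-- **The listed pairs' served piece-links AT EVERY CENTRE** (`(M, n) ∈ 𝒞.SMn O`, one vertex type): the input of the chosen orientation's map `oriφ Φ.φ (O.ori t M n)` at the SERVED
near sign `sgQ O.qd O.qdT O.ori t M n fam` (any far sign `τ`), realised at `c`, from the family of `AtQNQ`. [cite: KozmaNitzan2024, §4 pp. 19–21 ((21)–(25))] -/
theorem inputsAt_of_atQNQ {κ : Consts} {Φ : PlanarSkeletonFrmFrom G} {t : V} {p : unitInterval} {hC : Φ.CylSubcritical p} {O : OutNS V} {q : unitInterval} (𝒞 : ChoiceNQ κ Φ t p hC) (hAt : 𝒞.AtQNQ O q) (h1 : Φ.types = {t}) (c : V) {M n : ℕ} (hMn : (M, n) ∈ 𝒞.SMn O)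
    (fam : Fin 2) (τ : ℤˣ) :
    1 - 𝒞.δI < (bondPercolation G q).real
      (eventNAt G (oriφ Φ.φ (O.ori t M n)) O.merged.toDataN t c (M, some (n, fam, Skelφ.StepI.sgQ O.qd O.qdT O.ori t M n fam, τ))) := by
  obtain ⟨hfacts, -, -, hin, -⟩ := hAt
  obtain ⟨-, -, -, -, hΛ, e1, e2, e3, -, -, -⟩ := hfacts.1
  simp only [Skelφ.StepI.OutNS.toOutO_D, Skelφ.StepI.OutNS.toOutO_DT] at hΛ e1 e2 e3
  obtain ⟨α, hαt, hφ⟩ := exists_frame_of_types_eq' Φ h1 c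
  have ht : t ∈ ({t} : Finset V) := Finset.mem_singleton_self t
  have h := hin _ (Skelφ.StepI.mem_indexNQ_some ht hMn fam τ)
  rw [Skelφ.StepI.eventO_some_eq_eventN_orient Φ.φ e1 e2 e3] at h
  rw [Skelφ.StepI.OutNS.merged_toDataN,
    Skelφ.StepI.real_eventNAt_frame₂ hαt hφ Φ.frame hC q (D := O.D.toDataN.orient O.DT.toDataN O.ori) hΛ (O.ori t M n)]
  exact h

/-- **At a listed pair whose served quadrant is `(E, N)` the served sign is `1`**: the `σ = 1` piece-links (E side halves for `fam = 0`, N top pieces for `fam = 1`) of the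
chosen orientation's map are `(1 − δI)`-likely at every centre. [cite: KozmaNitzan2024, §4 pp. 19–21] -/
theorem inputsAt_one_of_atQNQ {κ : Consts} {Φ : PlanarSkeletonFrmFrom G} {t : V} {p : unitInterval} {hC : Φ.CylSubcritical p} {O : OutNS V} {q : unitInterval} (𝒞 : ChoiceNQ κ Φ t p hC) (hAt : 𝒞.AtQNQ O q) (h1 : Φ.types = {t}) (c : V) {M n : ℕ} (hMn : (M, n) ∈ 𝒞.SMn O)
    (hquad : O.quad t M n = (1, 1)) (fam : Fin 2) (τ : ℤˣ) :
    1 - 𝒞.δI < (bondPercolation G q).real (eventNAt G (oriφ Φ.φ (O.ori t M n)) O.merged.toDataN t c (M, some (n, fam, 1, τ))) := by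
  have h := inputsAt_of_atQNQ 𝒞 hAt h1 c hMn fam τ
  rwa [Skelφ.StepI.OutNS.sgQ_eq_one_of_quad O hquad] at h

/-- **At the SELECTED pairs `(O.D.sM M₁, O.D.sN M₁ N)` the `σ = 1` piece-links are likely at every centre** (when the choice lists them) — the form the column's kit clauses consume
(`FactsNS.sel_quad`, (R-25)). [cite: KozmaNitzan2024, §4 pp. 19–21] -/
theorem inputsSelAt_of_atQNQ {κ : Consts} {Φ : PlanarSkeletonFrmFrom G} {t : V} {p : unitInterval} {hC : Φ.CylSubcritical p} {O : OutNS V} {q : unitInterval} (𝒞 : ChoiceNQ κ Φ t p hC) (hAt : 𝒞.AtQNQ O q) (h1 : Φ.types = {t}) (c : V) (M₁ N : ℕ)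
    (hMn : (O.D.sM M₁, O.D.sN M₁ N) ∈ 𝒞.SMn O) (fam : Fin 2) (τ : ℤˣ) :
    1 - 𝒞.δI < (bondPercolation G q).real
      (eventNAt G (oriφ Φ.φ (O.ori t (O.D.sM M₁) (O.D.sN M₁ N))) O.merged.toDataN t c (O.D.sM M₁, some (O.D.sN M₁ N, fam, 1, τ))) :=
  inputsAt_one_of_atQNQ 𝒞 hAt h1 c hMn (hAt.1.sel_quad M₁ N) fam τ

/-- **The uniqueness zone at every listed zone size, at every centre** (`UniqZone.zone G (O.merged.Λ c) O.merged.k M`, `M ∈ 𝒞.Sz O`). [this work] -/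
theorem zoneAt_of_atQNQ {κ : Consts} {Φ : PlanarSkeletonFrmFrom G} {t : V} {p : unitInterval} {hC : Φ.CylSubcritical p} {O : OutNS V} {q : unitInterval} (𝒞 : ChoiceNQ κ Φ t p hC) (hAt : 𝒞.AtQNQ O q) (h1 : Φ.types = {t}) (c : V) {M : ℕ} (hM : M ∈ 𝒞.Sz O) :
    1 - 𝒞.δI < (bondPercolation G q).real (UniqZone.zone G (O.merged.Λ c) O.merged.k M) := by
  obtain ⟨hfacts, -, -, hin, -⟩ := hAt
  obtain ⟨-, -, -, -, hΛ, -⟩ := hfacts.1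
  simp only [Skelφ.StepI.OutNS.toOutO_D] at hΛ
  obtain ⟨α, hαt, hφ⟩ := exists_frame_of_types_eq' Φ h1 c
  have ht : t ∈ ({t} : Finset V) := Finset.mem_singleton_self t
  have hz := hin _ (Skelφ.StepI.mem_indexNQ_none ht hM)
  rw [Skelφ.StepI.eventO_none] at hz
  have h := Skelφ.StepI.real_eventNAt_frame₂ hαt hφ Φ.frame hC q (D := O.D.toDataN.orient O.DT.toDataN O.ori) hΛ true (M, none)
  rw [Skelφ.StepI.eventNAt_none, Skelφ.StepI.eventN_none] at h
  have e : (bondPercolation G q).real (UniqZone.zone G (O.merged.Λ c) O.merged.k M) =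
      (bondPercolation G q).real (UniqZone.zone G (O.D.toDataN.Λ t) O.D.toDataN.k M) := h
  rw [e]; exact hz

end ChoiceNQ

end PlanarSkeletonFrmFrom

end Summit.CriticalPhenomena.PercolationContinuityZ3.Theorems.Transplant

end
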